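import Literature.NumberTheory.Automorphic.WeightForms
import Mathlib.RepresentationTheory.Invariants
import HarnessLib

/-!
# Weight forms on a set of double-coset representatives: `𝒜(Γ, κ, τ) ≅ ⊕ᵢ W^{Δᵢ}`

Topic `NumberTheory/Automorphic`; namespace `Literature.NumberTheory.Automorphic.WeightForms`
(continues `WeightForms`). Generic over a group `G ⊇ Γ`, a weight-and-level homomorphism
`κ : Kc →* G` and a weight `τ : Representation R Kc W`.

The **definite-case dimension formula**. Balasubramanyam–Majumdar (in *p-adic aspects of modular
forms*, §3.1, e-text chunk 85/348), verbatim: "By taking representatives `t_i ∈ G(𝔸_F^∞)` for this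
finite set, we get a decomposition `G(𝔸_F^∞) = ⊔_i G(F) t_i U`. Such a decomposition induces an
isomorphism `S_λ(U, A) ⟶ ⊕_i (M_λ ⊗ A)^{U ∩ t_i^{-1} G(F) t_i}` by sending `f ↦ (f(t_i))_i`."
Here, PROVED for any group `G ⊇ Γ` and any `κ`, `τ`:

* `IsDoubleCosetSection Γ κ S`: `S ⊆ G` meets every double coset `Γ g κ(Kc)` exactly once
  (`isDoubleCosetSection_range_out`: `Quotient.out` representatives are a section);
* `stabWeight Γ κ s = κ⁻¹(s⁻¹ Γ s) ≤ Kc` ("`Γ_i = U ∩ t_i⁻¹ G(F) t_i`" read in `Kc`);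
* `sectionValues Γ κ τ S = {w : S → W | w s ∈ W^{stabWeight s}}` and the PROVED statements
  `evalAt_mem_sectionValues`, `evalAt_surjOn_sectionValues` (every compatible family of values IS
  a form — the construction `f (γ s κ(k)) := τ(k)⁻¹ w_s` and its well-definedness),
  `range_evalAt`, and the linear equivalence `evalEquiv : weightForms Γ κ τ ≃ₗ[R] sectionValues Γ κ τ S`
  (`LinearEquiv.ofBijective` on the proved bijection; no choice of data beyond that);
* over a field and a finite section, `finrank_weightForms : dim 𝒜 = ∑_{s ∈ S} dim W^{Δ_s}`.

All statements are proved; cite tags are provenance.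
-/

namespace Literature.NumberTheory.Automorphic

namespace WeightForms

universe u v w

variable {G : Type*} [Group G] {Kc : Type*} [Group Kc]
variable {R : Type*} [CommRing R] {W : Type*} [AddCommGroup W] [Module R W]

/-! ### Sections of the double coset space and the stabilisers `Δ_s` -/

section Section

variable (Γ : Subgroup G) (κ : Kc →* G)

/-- `S ⊆ G` is a **set of representatives** of `Γ \ G / κ(Kc)`: it meets every double coset
(`IsDoubleCosetCover`) and two members of `S` in the same double coset are equal. [folklore] -/
def IsDoubleCosetSection (S : Set G) : Prop :=
  IsDoubleCosetCover Γ κ S ∧ ∀ s ∈ S, ∀ s' ∈ S, ∀ γ ∈ Γ, ∀ k : Kc, γ * s * κ k = s' → s = s'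

/-- The **weight stabiliser** of `s`: `Δ_s = {k ∈ Kc | s κ(k) s⁻¹ ∈ Γ} = κ⁻¹(s⁻¹ Γ s)`
(B.–M.: "`Γ_i = U ∩ t_i^{-1} G(F) t_i`"). [folklore] -/
def stabWeight (s : G) : Subgroup Kc :=
  Γ.comap ((MulAut.conj s).toMonoidHom.comp κ)

variable {Γ κ}

/-- `k ∈ Δ_s ↔ s κ(k) s⁻¹ ∈ Γ`. [folklore] -/
@[simp] theorem mem_stabWeight_iff {s : G} {k : Kc} :
    k ∈ stabWeight Γ κ s ↔ s * κ k * s⁻¹ ∈ Γ := Iff.rfl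

/-- `k ∈ Δ_s` iff `γ s κ(k) = s` for some `γ ∈ Γ` (namely `γ = (s κ(k) s⁻¹)⁻¹`). [folklore] -/
theorem mem_stabWeight_iff_exists {s : G} {k : Kc} :
    k ∈ stabWeight Γ κ s ↔ ∃ γ ∈ Γ, γ * s * κ k = s := by
  constructor
  · intro h
    exact ⟨(s * κ k * s⁻¹)⁻¹, inv_mem h, by group⟩
  · rintro ⟨γ, hγ, h⟩
    have h' : s * κ k = γ⁻¹ * s := by rw [eq_inv_mul_iff_mul_eq, ← mul_assoc, h]
    have : s * κ k * s⁻¹ = γ⁻¹ := by rw [h', mul_inv_cancel_right]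
    rw [mem_stabWeight_iff, this]
    exact inv_mem hγ

/-- The `Quotient.out` representatives of `Γ \ G / κ(Kc)` form a section. [folklore] -/
theorem isDoubleCosetSection_range_out :
    IsDoubleCosetSection Γ κ
      (Set.range fun q : DoubleCoset.Quotient (Γ : Set G) (κ.range : Set G) ↦ q.out) := by
  refine ⟨isDoubleCosetCover_range_out, ?_⟩
  rintro _ ⟨q, rfl⟩ _ ⟨q', rfl⟩ γ hγ k h
  have hq : q = q' := by
    rw [← DoubleCoset.out_eq' (Γ : Subgroup G) κ.range q,
      ← DoubleCoset.out_eq' (Γ : Subgroup G) κ.range q', DoubleCoset.eq]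
    exact ⟨γ, hγ, κ k, ⟨k, rfl⟩, h.symm⟩
  rw [hq]

end Section

/-! ### The values of a form on a section -/

section Values

variable (Γ : Subgroup G) (κ : Kc →* G) (τ : Representation R Kc W)

/-- **Compatible families of values** on `S`: `w s ∈ W^{Δ_s}` for every `s ∈ S` — the module
`⊕_{s ∈ S} W^{Δ_s}` of B.–M. §3.1 as a submodule of `S → W`. [folklore] -/
def sectionValues (S : Set G) : Submodule R (S → W) where
  carrier := {w | ∀ (s : S), ∀ k ∈ stabWeight Γ κ (s : G), τ k (w s) = w s}
  zero_mem' _ _ _ := by simp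
  add_mem' hw hw' s k hk := by rw [Pi.add_apply, map_add, hw s k hk, hw' s k hk]
  smul_mem' c _ hw s k hk := by rw [Pi.smul_apply, map_smul, hw s k hk]

variable {Γ κ τ}

/-- Membership in `sectionValues`. [folklore] -/
theorem mem_sectionValues_iff {S : Set G} {w : S → W} :
    w ∈ sectionValues Γ κ τ S ↔ ∀ (s : S), ∀ k ∈ stabWeight Γ κ (s : G), τ k (w s) = w s :=
  Iff.rfl

/-- The values of a form on any set lie in `⊕ W^{Δ_s}` (`evalAt_mem_invariants`). [folklore] -/
theorem evalAt_mem_sectionValues (S : Set G) (f : weightForms Γ κ τ) :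
    evalAt Γ κ τ S f ∈ sectionValues Γ κ τ S := by
  intro s k hk
  obtain ⟨γ, hγ, h⟩ := mem_stabWeight_iff_exists.mp hk
  rw [evalAt_apply]
  exact evalAt_mem_invariants f.2 hγ h

/-- **Well-definedness of the inverse.** If `γ s κ(k) = γ' s' κ(k')` with `s, s'` in a section, then
`s = s'` and `τ(k)⁻¹ w_s = τ(k')⁻¹ w_{s'}` for every compatible family `w`. [folklore] -/
theorem section_wd {S : Set G} (hS : IsDoubleCosetSection Γ κ S) {w : S → W}
    (hw : w ∈ sectionValues Γ κ τ S) {s s' : G} (hs : s ∈ S) (hs' : s' ∈ S) {γ γ' : G}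
    (hγ : γ ∈ Γ) (hγ' : γ' ∈ Γ) {k k' : Kc} (h : γ * s * κ k = γ' * s' * κ k') :
    s = s' ∧ τ k⁻¹ (w ⟨s, hs⟩) = τ k'⁻¹ (w ⟨s', hs'⟩) := by
  have hss' : s = s' :=
    hS.2 s hs s' hs' (γ'⁻¹ * γ) (mul_mem (inv_mem hγ') hγ) (k * k'⁻¹) (by
      rw [map_mul, map_inv, ← mul_assoc, mul_assoc γ'⁻¹, mul_assoc γ'⁻¹ (γ * s), h]
      group)
  subst hss'
  refine ⟨rfl, ?_⟩
  have hmem : k * k'⁻¹ ∈ stabWeight Γ κ s := by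
    have h1 : s * κ k = γ⁻¹ * (γ' * s * κ k') := by rw [eq_inv_mul_iff_mul_eq, ← mul_assoc, h]
    have h2 : s * κ (k * k'⁻¹) * s⁻¹ = γ⁻¹ * γ' := by
      rw [map_mul, map_inv, ← mul_assoc, h1]
      group
    rw [mem_stabWeight_iff, h2]
    exact mul_mem (inv_mem hγ) hγ'
  have hfix := hw ⟨s, hs⟩ (k * k'⁻¹) hmem
  rw [map_mul, Module.End.mul_apply] at hfix
  calc τ k⁻¹ (w ⟨s, hs⟩) = τ k⁻¹ (τ k (τ k'⁻¹ (w ⟨s, hs⟩))) := by rw [hfix]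
    _ = τ k'⁻¹ (w ⟨s, hs⟩) := by
      rw [← Module.End.mul_apply (f := τ k⁻¹), ← map_mul, inv_mul_cancel, map_one,
        Module.End.one_apply]

/-- **Every compatible family of values is the restriction of a form** (B.–M. §3.1: the map
`f ↦ (f(t_i))_i` is onto `⊕_i (M_λ ⊗ A)^{Γ_i}`): `f (γ s κ(k)) := τ(k)⁻¹ w_s`. [folklore] -/
theorem evalAt_surjOn_sectionValues {S : Set G} (hS : IsDoubleCosetSection Γ κ S) {w : S → W}
    (hw : w ∈ sectionValues Γ κ τ S) : ∃ f : weightForms Γ κ τ, evalAt Γ κ τ S f = w := by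
  classical
  choose sel hsel γ hγ k hdec using hS.1
  -- `f g := τ (k g)⁻¹ (w (sel g))`; `key`: its value computed from ANY decomposition of `g`.
  have key : ∀ (g s : G) (hs : s ∈ S) (γ' : G) (_ : γ' ∈ Γ) (k' : Kc), g = γ' * s * κ k' →
      τ (k g)⁻¹ (w ⟨sel g, hsel g⟩) = τ k'⁻¹ (w ⟨s, hs⟩) := fun g s hs γ' hγ' k' hg ↦
    (section_wd hS hw (hsel g) hs (hγ g) hγ' (k := k g) (k' := k') (by rw [← hdec g, hg])).2
  refine ⟨⟨fun g ↦ τ (k g)⁻¹ (w ⟨sel g, hsel g⟩), fun γ₀ hγ₀ g ↦ ?_, fun k₀ g ↦ ?_⟩, ?_⟩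
  · exact key (γ₀ * g) (sel g) (hsel g) (γ₀ * γ g) (mul_mem hγ₀ (hγ g)) (k g)
      (by rw [mul_assoc, mul_assoc, ← mul_assoc (γ g), ← hdec g])
  · dsimp only
    rw [key (g * κ k₀) (sel g) (hsel g) (γ g) (hγ g) (k g * k₀)
      (by rw [map_mul, ← mul_assoc, ← hdec g]), mul_inv_rev, map_mul, Module.End.mul_apply]
  · funext s
    rw [evalAt_apply]
    change τ (k s)⁻¹ (w ⟨sel s, hsel s⟩) = w s
    rw [key s s s.2 1 (one_mem Γ) 1 (by rw [one_mul, map_one, mul_one]), inv_one, map_one,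
      Module.End.one_apply]

/-- The image of `f ↦ (f s)_{s ∈ S}` on a section is exactly `⊕_{s ∈ S} W^{Δ_s}`. [folklore] -/
theorem range_evalAt {S : Set G} (hS : IsDoubleCosetSection Γ κ S) :
    LinearMap.range (evalAt Γ κ τ S) = sectionValues Γ κ τ S := by
  refine le_antisymm ?_ fun w hw ↦ ?_
  · rintro _ ⟨f, rfl⟩
    exact evalAt_mem_sectionValues S f
  · obtain ⟨f, hf⟩ := evalAt_surjOn_sectionValues hS hw
    exact ⟨f, hf⟩

variable (Γ κ τ)

/-- **`𝒜(Γ, κ, τ) ≅ ⊕_{s ∈ S} W^{Δ_s}`, `f ↦ (f s)_s`** for a section `S` of `Γ \ G / κ(Kc)`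
(B.–M. §3.1): the linear equivalence induced by the PROVED bijection
`evalAt` (injective: `evalAt_injective`; onto: `evalAt_surjOn_sectionValues`). [folklore] -/
noncomputable def evalEquiv {S : Set G} (hS : IsDoubleCosetSection Γ κ S) :
    weightForms Γ κ τ ≃ₗ[R] sectionValues Γ κ τ S :=
  LinearEquiv.ofBijective
    ((evalAt Γ κ τ S).codRestrict (sectionValues Γ κ τ S) (evalAt_mem_sectionValues S))
    ⟨fun _ _ h ↦ evalAt_injective hS.1 (congr_arg Subtype.val h),
      fun w ↦ (evalAt_surjOn_sectionValues hS w.2).imp fun _ hf ↦ Subtype.ext hf⟩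

variable {Γ κ τ}

/-- `evalEquiv hS f s = f s`. [folklore] -/
@[simp] theorem evalEquiv_apply {S : Set G} (hS : IsDoubleCosetSection Γ κ S)
    (f : weightForms Γ κ τ) (s : S) : (evalEquiv Γ κ τ hS f : S → W) s = (f : G → W) s := rfl

variable (Γ κ τ)

/-- `⊕_{s ∈ S} W^{Δ_s}` as a product of the invariant submodules
`(τ|_{Δ_s}).invariants` — the identity map, repackaged. [folklore] -/
def sectionValuesEquivPi (S : Set G) :
    sectionValues Γ κ τ S ≃ₗ[R]
      Π s : S, Representation.invariants (τ.comp (stabWeight Γ κ (s : G)).subtype) where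
  toFun w s := ⟨(w : S → W) s, fun k ↦ w.2 s k k.2⟩
  invFun v := ⟨fun s ↦ (v s : W), fun s k hk ↦ (v s).2 ⟨k, hk⟩⟩
  left_inv _ := rfl
  right_inv _ := rfl
  map_add' _ _ := rfl
  map_smul' _ _ := rfl

end Values

/-! ### The dimension formula over a field -/

section Finrank

variable {K : Type*} [Field K] {V : Type*} [AddCommGroup V] [Module K V]
variable (Γ : Subgroup G) (κ : Kc →* G) (τ : Representation K Kc V)

/-- **Dimension formula** (definite case): for a FINITE section `S` of `Γ \ G / κ(Kc)` and a
finite-dimensional weight, `dim_K 𝒜(Γ, κ, τ) = ∑_{s ∈ S} dim_K V^{Δ_s}` (B.–M. §3.1: "the space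
`S_λ(U, E)` is a finite dimensional `E` vector space" with the displayed isomorphism). [folklore] -/
theorem finrank_weightForms [FiniteDimensional K V] {S : Set G} [Fintype S]
    (hS : IsDoubleCosetSection Γ κ S) :
    Module.finrank K (weightForms Γ κ τ) =
      ∑ s : S,
        Module.finrank K (Representation.invariants (τ.comp (stabWeight Γ κ (s : G)).subtype)) := by
  rw [((evalEquiv Γ κ τ hS).trans (sectionValuesEquivPi Γ κ τ S)).finrank_eq,
    Module.finrank_pi_fintype]

end Finrank

end WeightForms

end Literature.NumberTheory.Automorphic
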